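import Literature.Computability.Complexity.PolyHierarchy

/-!
# PneNP / SzkEntropy — support `PhCollapse` (stmt-PneNP-13909), route-independent proof

Route `PneNP/SzkEntropy`, support item stmt-PneNP-13909 (`PhCollapse`, rev-3 re-filing of the proved
stmt-PneNP-1503):

  `Nondeterministic.NP ⊆ Classes.P → PH ⊆ Classes.P`.

The textbook collapse of the polynomial hierarchy under `P = NP`: by induction on `k`,
`Σₖ₊₁ᵖ = ∃ᵖ·co(Σₖᵖ) ⊆ ∃ᵖ·co(P) = ∃ᵖ·P = NP ⊆ P`, using monotonicity of the certificate operator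
`polyExists` and of `co`, closure of `P` under complement (`co_P_holds`), and
`Nondeterministic.NP = polyExists Classes.P` (definitional); then `PH = ⋃ₖ Σₖᵖ ⊆ P`.

This file deliberately imports NEITHER the route file `Summits.PneNP.PneNP.Theses.SzkEntropy` NOR any
`Theorems/SzkEntropy*.lean` (the earlier proof `szkEntropy_phCollapse_proof` imports the route file,
and the gate's `_holds` link imports the proving module into the route file — an import cycle at
route rev 3, 2026-08-15); the statement is spelled structurally, exactly as the item's signature.

References: S. Arora, B. Barak, *Computational Complexity: A Modern Approach* (2009), Thm 5.4
("if P = NP then PH = P"); L. Stockmeyer, *The polynomial-time hierarchy*, TCS 3 (1976), §3.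
-/

namespace Summit.PneNP.PneNP.Theorems

open Literature.Computability.Complexity

/-- **`PhCollapse` holds** (route SzkEntropy, item stmt-PneNP-13909; same term as stmt-PneNP-1503):
`NP ⊆ P → PH ⊆ P`.  `PH = ⋃ₖ Σₖᵖ`, and every level collapses, `Σₖᵖ ⊆ P`, by induction on `k`
(`Σ₀ᵖ = P`; `Σₖ₊₁ᵖ = polyExists (co Σₖᵖ) ⊆ polyExists (co P) = polyExists P = NP ⊆ P`, by
`SigmaP_succ`, `PiP_eq_co`, `polyExists_mono`, `co_mono`, `co_P_holds`).  (The induction is inlined: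
its stand-alone form is `SigmaP_subset_P_of_NP_subset_P` of `Theorems/SzkEntropyPhCollapse.lean`,
which this file must not import.) [AroraBarakCC2009, Thm 5.4; Stockmeyer1976, §3] -/
theorem szkEntropy_phCollapse_standalone :
    (Nondeterministic.NP ⊆ Classes.P) → (PH ⊆ Classes.P) := by
  intro hNP L hL
  have hL' : L ∈ ⋃ k, SigmaP k := hL
  obtain ⟨k, hk⟩ := Set.mem_iUnion.1 hL'
  clear hL hL'
  induction k generalizing L with
  | zero => exact hk
  | succ k ih =>
    have h₁ : L ∈ polyExists (co (SigmaP k)) := by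
      rw [← PiP_eq_co, ← SigmaP_succ]; exact hk
    have hcoP : co Classes.P = Classes.P := co_P_holds
    have h₂ : L ∈ polyExists Classes.P := hcoP ▸ polyExists_mono (co_mono fun _ hL' => ih hL') h₁
    exact hNP h₂

end Summit.PneNP.PneNP.Theorems
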